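import Literature.NumberTheory.ModularSymbols.CuspidalHomologyShiftSubOneFibreModThree
import Mathlib.LinearAlgebra.TensorProduct.RightExactness
import HarnessLib

/-!
# `H(N; R) ↠ V₁(R)` with kernel `B_R`: the Hecke-module dictionary `V₁(R) ≅ H(N; R)/B_R`
# (the lattice side of `(J₀(N)/B)[n] = J₀(N)[n]/B[n]`)

Third sequel of `CuspidalHomologyShiftNorm` for bsd-stepL LINE 28 (bsd-idea-3 memo §13.10 (i): "`Φ₁ = (J/B)[3]^t`
sits between `J[3]^t/B[3]^t` and `H¹(⟨t⟩, B[3])`"; ask post38 (b) "the `J₀(N)[3] ↔ V₁(𝔽₃)`-fibre dictionary").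
Everything is proved; no named facts, no instances, no notation; no Galois action is assumed or used — this is
the HECKE-MODULE half of the dictionary (the Galois half is the tree's hypothesis structure
`ModularJacobianGaloisData.galAct` on `J0.tors` together with `J0.exists_linearDivMap : Λ/ℓΛ ≅ J₀(N)[ℓ]`).

Notation: `Λ = H₁(X₀(N), ℤ)` (`periodHomologyHecke N`), `H(N; R) = R ⊗ Λ` (`CuspidalHomologyHeckeModule N R`, p660800),
`t = shift`, `T_p = heckeOp`, `Λ_B = fixedLattice = ker(t − 1)` (p661679), `Λ₁ = (t − 1)Λ`, `V₁(R) = R ⊗ Λ₁` with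
`t̄ = shiftOneR`, `T̄_p = heckeOneR` (p662714), `toShiftSubOne : Λ ↠ Λ₁` (p666957).

* §1 `fixedLatticeFibre R = B_R ⊆ H(N; R)`: the image of `R ⊗ Λ_B` (for `R = 𝔽₃` the avatar of `B[3] ⊂ J₀(N)[3]`,
  `B = Nm J₀(N) ≅ J₀(3M)`): `t = 1` on it (`B_R ≤ fixedPart`, i.e. `B[3] ⊆ J[3]^t`), `T_p`-stable (`p ≠ 3`).
* §2 `homologyToFibre R : H(N; R) ↠ V₁(R)`, `r ⊗ y ↦ r ⊗ (t − 1)y` (base change of `toShiftSubOne`): ONTO with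
  **kernel exactly `B_R`** (`ker_homologyToFibre`, right exactness of `R ⊗ −` applied to
  `0 → Λ_B → Λ → Λ₁ → 0`, Mathlib `lTensor_exact`) — so `V₁(R) ≅ H(N; R)/B_R`, for `R = 𝔽₃`: `V₁(𝔽₃) ≅ J[3]/B[3]`
  as Hecke modules up to the twist below; `t`-equivariant, `T_p`-equivariant for `p ≡ 1 (mod 3)`, and
  `χ₋₃`-semilinear for `p ≡ 2 (mod 3)`: `homologyToFibre ∘ T_p = T̄_p ∘ (t̄ + 1) ∘ homologyToFibre`.
* §3 The pieces of `Φ₁ = ker(1 − t̄) ⊆ V₁(R)` seen upstairs: `homologyToFibre v ∈ Φ₁ ↔ t v − v ∈ B_R`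
  (`homologyToFibre_mem_ker_iff`); the `t`-fixed part `fixedPart = ker(t − 1) ⊆ H(N; R)` (avatar of `J[3]^t`)
  maps into `Φ₁`; and the "connecting" vector `t v − v ∈ B_R` vanishes iff `v ∈ fixedPart` — i.e. the exact
  sequence `0 → (H^t + B_R)/B_R → Φ₁ → B_R` of memo §13.10 (i) (`H¹(⟨t⟩, B_R) = B_R` since `t = 1` on `B_R`), in
  elementwise form.
* §4 (over `𝔽₃`) the `⟨t⟩`-invariants REDUCTION with the Hecke twists made explicit: `Φ₁ ∩ V₁[c^∞] = 0` as soon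
  as `H^t ∩ H[(χ₋₃ c)^∞] ⊆ B_{𝔽₃}` and `B_{𝔽₃} ∩ H[c^∞] = 0`
  (`genIsotypicOne_inf_ker_eq_bot_of_fixedPart_of_fixedLatticeFibre`), whence the saturation hypothesis
  `V₁[a^∞] ⊆ (1 − t̄)V₁` of LINE 28 from `H^t ∩ H[a^∞] ⊆ B_{𝔽₃}` and `B_{𝔽₃} ∩ H[(χ₋₃ a)^∞] = 0`
  (`genIsotypicOne_le_range_of_fixedPart_of_fixedLatticeFibre`). No Galois action is used.

## References

* A. Hatcher, *Algebraic Topology*, CUP 2002, §3.A (coefficients; right exactness of `⊗`).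
* M. Harrison, the `X₀(108)` shift computations, 2011, §2 (the shift `t`, `B = Nm J`).
* F. Diamond, J. Shurman, *A First Course in Modular Forms*, GTM 228, 2005, Prop. 5.2.2(a), §6.3.
* N. Jacobson, *Basic Algebra II*, 2nd ed., Freeman 1989, §3.4 Fitting's lemma (38), p. 113.
-/

noncomputable section

namespace Literature.NumberTheory.ModularSymbols

open Literature.NumberTheory.EllipticCurves Literature.NumberTheory.EllipticCurves.ModularForms CongruenceSubgroup
open scoped TensorProduct

/-! ### §1 `B_R`: the image of `R ⊗ Λ_B` in `H(N; R)` -/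

section FixedLatticeFibre

variable (N : ℕ) [NeZero N] (h9 : 3 ^ 2 ∣ N) (R : Type*) [CommRing R]

/-- **`B_R ⊆ H(N; R)`**: the image of `R ⊗ Λ_B → R ⊗ Λ`, `Λ_B = ker(t − 1)` the fixed lattice (for `R = ℤ/n`
the lattice avatar of `B[n] ⊂ J₀(N)[n]`, `B = Nm J₀(N)`; in general NOT all of `fixedPart = ker(t − 1)` on
`H(N; R)`, since `Λ_B` is saturated in `Λ` but `t − 1` acquires new kernel mod `n`). [cite: Harrison2011X0108, §2 (derived reading: the sublattice Λ^t and its reduction)] -/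
def fixedLatticeFibre : Submodule R (CuspidalHomologyHeckeModule N R) :=
  LinearMap.range ((fixedLattice N h9).subtype.baseChange R)

/-- `r ⊗ x ∈ B_R` for `x ∈ Λ_B`. [cite: Harrison2011X0108, §2 (derived reading)] -/
theorem tmul_mem_fixedLatticeFibre (r : R) {x : periodHomologyHecke N} (hx : x ∈ fixedLattice N h9) :
    r ⊗ₜ[ℤ] x ∈ fixedLatticeFibre N h9 R :=
  ⟨r ⊗ₜ[ℤ] ⟨x, hx⟩, rfl⟩

/-- **`t = 1` on `B_R`** (`t x = x` on `Λ_B`). [cite: Harrison2011X0108, §2 (derived reading)] -/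
theorem shift_apply_eq_self_of_mem_fixedLatticeFibre {v : CuspidalHomologyHeckeModule N R}
    (hv : v ∈ fixedLatticeFibre N h9 R) : shift N h9 R v = v := by
  obtain ⟨w, rfl⟩ := hv
  have h : shift N h9 R ∘ₗ (fixedLattice N h9).subtype.baseChange R = (fixedLattice N h9).subtype.baseChange R := by
    refine TensorProduct.AlgebraTensorModule.ext fun r x ↦ ?_
    simp only [LinearMap.comp_apply, LinearMap.baseChange_tmul, Submodule.subtype_apply, shift_tmul,
      (mem_fixedLattice_iff N h9 _).mp x.2]
  exact LinearMap.congr_fun h w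

/-- `B_R ≤ fixedPart` (`B[3] ⊆ J[3]^t`). [cite: Harrison2011X0108, §2 (derived reading)] -/
theorem fixedLatticeFibre_le_fixedPart : fixedLatticeFibre N h9 R ≤ fixedPart N h9 R := fun _ hv ↦
  (mem_fixedPart_iff N h9 R _).mpr (shift_apply_eq_self_of_mem_fixedLatticeFibre N h9 R hv)

variable {N R} in
/-- **`B_R` is `T_p`-stable** (`p ≠ 3`; `Λ_B` is, `T_smul_mem_fixedLattice`). [cite: DiamondShurman2005, Prop. 5.2.2(a) (derived reading, see `T_smul_mem_fixedLattice`)] -/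
theorem heckeOp_mem_fixedLatticeFibre {p : ℕ} (hp : p.Prime) (hp3 : p ≠ 3) {v : CuspidalHomologyHeckeModule N R}
    (hv : v ∈ fixedLatticeFibre N h9 R) : heckeOp N R p hp v ∈ fixedLatticeFibre N h9 R := by
  obtain ⟨w, rfl⟩ := hv
  -- `T_p` restricted to `Λ_B`
  let TB : Module.End ℤ (fixedLattice N h9) :=
    (heckeInt N (HeckeRing0.T N 2 p hp)).restrict fun x hx ↦ T_smul_mem_fixedLattice h9 hp hp3 hx
  have h : heckeOp N R p hp ∘ₗ (fixedLattice N h9).subtype.baseChange R =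
      (fixedLattice N h9).subtype.baseChange R ∘ₗ TB.baseChange R := by
    refine TensorProduct.AlgebraTensorModule.ext fun r x ↦ ?_
    simp only [LinearMap.comp_apply, LinearMap.baseChange_tmul, Submodule.subtype_apply, heckeOp_tmul]
    rfl
  exact ⟨TB.baseChange R w, (LinearMap.congr_fun h w).symm⟩

end FixedLatticeFibre

/-! ### §2 `homologyToFibre : H(N; R) ↠ V₁(R)`, kernel `B_R` -/

section HomologyToFibre

variable (N : ℕ) [NeZero N] (h9 : 3 ^ 2 ∣ N) (R : Type*) [CommRing R]

/-- **`H(N; R) → V₁(R)`, `r ⊗ y ↦ r ⊗ (t y − y)`** (base change of `toShiftSubOne : Λ ↠ Λ₁`; for `R = ℤ/n` the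
lattice avatar of `J₀(N)[n] → (J₀(N)/B)[n]`). [cite: HatcherAT2002, §3.A Cor. 3A.4 (derived reading, with Harrison 2011 §2 for t)] -/
def homologyToFibre : CuspidalHomologyHeckeModule N R →ₗ[R] ShiftSubOneModule N h9 R :=
  (toShiftSubOne N h9).baseChange R

/-- `homologyToFibre (r ⊗ y) = r ⊗ (t y − y)`. [cite: HatcherAT2002, §3.A Cor. 3A.4 (derived reading)] -/
@[simp] theorem homologyToFibre_tmul (r : R) (y : periodHomologyHecke N) :
    homologyToFibre N h9 R (r ⊗ₜ[ℤ] y) = r ⊗ₜ[ℤ] toShiftSubOne N h9 y :=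
  LinearMap.baseChange_tmul _ _ _

/-- `homologyToFibre` agrees with Mathlib's `lTensor` of `toShiftSubOne` pointwise. [cite: HatcherAT2002, §3.A Cor. 3A.4 (derived reading)] -/
theorem homologyToFibre_apply_eq_lTensor (v : CuspidalHomologyHeckeModule N R) :
    homologyToFibre N h9 R v = (toShiftSubOne N h9).lTensor R v :=
  congrFun (LinearMap.baseChange_eq_ltensor (toShiftSubOne N h9)) v

/-- **`H(N; R) → V₁(R)` is onto** (`Λ → Λ₁` is, and `R ⊗ −` preserves surjections).
[cite: HatcherAT2002, §3.A Cor. 3A.4 (derived reading: right exactness of ⊗)] -/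
theorem homologyToFibre_surjective : Function.Surjective (homologyToFibre N h9 R) := by
  intro v
  obtain ⟨w, hw⟩ := LinearMap.lTensor_surjective R (toShiftSubOne_surjective N h9) v
  exact ⟨w, by rw [homologyToFibre_apply_eq_lTensor, hw]⟩

/-- **The kernel of `H(N; R) → V₁(R)` is exactly `B_R`** (right exactness of `R ⊗ −` on
`0 → Λ_B → Λ → Λ₁ → 0`, Mathlib `lTensor_exact`): `V₁(R) ≅ H(N; R)/B_R`; for `R = 𝔽₃`, with `J[3] ≅ Λ/3Λ = H(N; 𝔽₃)`
(`J0.exists_linearDivMap`) and `B[3] ↔ B_{𝔽₃}`, this is `V₁(𝔽₃) ≅ J₀(N)[3]/B[3] = (J₀(N)/B)[3]`.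
[cite: HatcherAT2002, §3.A Cor. 3A.4 (derived reading: right exactness of ⊗)] -/
theorem ker_homologyToFibre : LinearMap.ker (homologyToFibre N h9 R) = fixedLatticeFibre N h9 R := by
  have hex : Function.Exact (fixedLattice N h9).subtype (toShiftSubOne N h9) :=
    LinearMap.exact_iff.mpr (by rw [ker_toShiftSubOne, Submodule.range_subtype])
  have h := lTensor_exact R hex (toShiftSubOne_surjective N h9)
  ext v
  rw [LinearMap.mem_ker, homologyToFibre_apply_eq_lTensor, fixedLatticeFibre, LinearMap.mem_range]
  constructor
  · intro hv
    obtain ⟨w, hw⟩ := (h v).mp hv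
    exact ⟨w, by rw [← hw]; exact congrFun (LinearMap.baseChange_eq_ltensor (fixedLattice N h9).subtype) w⟩
  · rintro ⟨w, rfl⟩
    refine (h _).mpr ⟨w, ?_⟩
    exact (congrFun (LinearMap.baseChange_eq_ltensor (fixedLattice N h9).subtype) w).symm

/-- `homologyToFibre v = 0 ↔ v ∈ B_R`. [cite: HatcherAT2002, §3.A Cor. 3A.4 (derived reading)] -/
theorem homologyToFibre_eq_zero_iff (v : CuspidalHomologyHeckeModule N R) :
    homologyToFibre N h9 R v = 0 ↔ v ∈ fixedLatticeFibre N h9 R := by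
  rw [← LinearMap.mem_ker, ker_homologyToFibre]

/-- **`t`-equivariance**: `homologyToFibre ∘ t = t̄ ∘ homologyToFibre`. [cite: Harrison2011X0108, §2 (derived reading)] -/
theorem homologyToFibre_comp_shift :
    homologyToFibre N h9 R ∘ₗ shift N h9 R = shiftOneR N h9 R ∘ₗ homologyToFibre N h9 R := by
  refine TensorProduct.AlgebraTensorModule.ext fun r x ↦ ?_
  simp only [LinearMap.comp_apply, shift_tmul, homologyToFibre_tmul, shiftOneR_tmul, toShiftSubOne_shiftInt]

/-- Pointwise `t`-equivariance. [cite: Harrison2011X0108, §2 (derived reading)] -/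
theorem homologyToFibre_shift (v : CuspidalHomologyHeckeModule N R) :
    homologyToFibre N h9 R (shift N h9 R v) = shiftOneR N h9 R (homologyToFibre N h9 R v) :=
  LinearMap.congr_fun (homologyToFibre_comp_shift N h9 R) v

variable {N R} in
/-- **`T_p`-equivariance for `p ≡ 1 (mod 3)`**: `homologyToFibre ∘ T_p = T̄_p ∘ homologyToFibre`.
[cite: DiamondShurman2005, Prop. 5.2.2(a) (derived reading, see `toShiftSubOne_T_smul_of_mod_three_eq_one`)] -/
theorem homologyToFibre_comp_heckeOp_of_mod_three_eq_one {p : ℕ} (hp : p.Prime) (hp3 : p ≠ 3) (hp1 : p % 3 = 1) :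
    homologyToFibre N h9 R ∘ₗ heckeOp N R p hp = heckeOneR h9 hp hp3 ∘ₗ homologyToFibre N h9 R := by
  refine TensorProduct.AlgebraTensorModule.ext fun r x ↦ ?_
  simp only [LinearMap.comp_apply, heckeOp_tmul, homologyToFibre_tmul, heckeOneR_tmul,
    toShiftSubOne_T_smul_of_mod_three_eq_one h9 hp hp3 hp1]

variable {N R} in
/-- **`χ₋₃`-semilinearity for `p ≡ 2 (mod 3)`**: `homologyToFibre ∘ T_p = T̄_p ∘ (t̄ + 1) ∘ homologyToFibre`
(`(t − 1)T_p = T_p(t + 1)(t − 1)`; on `Φ₁ = ker(1 − t̄)` over `𝔽₃` the factor `t̄ + 1` is `2 = −1 = χ₋₃(p)`).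
[cite: DiamondShurman2005, Prop. 5.2.2(a) (derived reading, see `toShiftSubOne_T_smul_of_mod_three_eq_two`)] -/
theorem homologyToFibre_comp_heckeOp_of_mod_three_eq_two {p : ℕ} (hp : p.Prime) (hp3 : p ≠ 3) (hp2 : p % 3 = 2) :
    homologyToFibre N h9 R ∘ₗ heckeOp N R p hp =
      heckeOneR h9 hp hp3 ∘ₗ (shiftOneR N h9 R + 1) ∘ₗ homologyToFibre N h9 R := by
  refine TensorProduct.AlgebraTensorModule.ext fun r x ↦ ?_
  simp only [LinearMap.comp_apply, heckeOp_tmul, homologyToFibre_tmul, LinearMap.add_apply, Module.End.one_apply,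
    shiftOneR_tmul, toShiftSubOne_T_smul_of_mod_three_eq_two h9 hp hp3 hp2]
  rw [← TensorProduct.tmul_add, heckeOneR_tmul]

end HomologyToFibre

/-! ### §3 `Φ₁ = ker(1 − t̄)` seen from `H(N; R)`: the exact sequence `0 → (H^t + B_R)/B_R → Φ₁ → B_R` -/

section PhiOne

variable (N : ℕ) [NeZero N] (h9 : 3 ^ 2 ∣ N) (R : Type*) [CommRing R]

/-- `(1 − t̄)(homologyToFibre v) = homologyToFibre (v − t v)`. [cite: Harrison2011X0108, §2 (derived reading)] -/
theorem one_sub_shiftOneR_homologyToFibre (v : CuspidalHomologyHeckeModule N R) :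
    (1 - shiftOneR N h9 R) (homologyToFibre N h9 R v) = homologyToFibre N h9 R (v - shift N h9 R v) := by
  rw [LinearMap.sub_apply, Module.End.one_apply, map_sub, homologyToFibre_shift]

/-- **`homologyToFibre v ∈ Φ₁ = ker(1 − t̄)` iff the "connecting vector" `t v − v` lies in `B_R`**
(memo §13.10 (i): the class `v̄ ∈ H/B_R` is `t̄`-fixed iff `(t − 1)v ∈ B_R`; the connecting map
`Φ₁ → H¹(⟨t⟩, B_R) = B_R` is `v̄ ↦ t v − v`). [cite: Harrison2011X0108, §2 (derived reading: V₁(R) = H(N;R)/B_R, `ker_homologyToFibre`)] -/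
theorem homologyToFibre_mem_ker_iff (v : CuspidalHomologyHeckeModule N R) :
    homologyToFibre N h9 R v ∈ LinearMap.ker (1 - shiftOneR N h9 R) ↔
      shift N h9 R v - v ∈ fixedLatticeFibre N h9 R := by
  rw [LinearMap.mem_ker, one_sub_shiftOneR_homologyToFibre, homologyToFibre_eq_zero_iff, ← neg_sub,
    Submodule.neg_mem_iff]

/-- The `t`-fixed part `H^t = fixedPart` (avatar of `J[n]^t`) maps into `Φ₁`. [cite: Harrison2011X0108, §2 (derived reading)] -/
theorem homologyToFibre_mem_ker_of_mem_fixedPart {v : CuspidalHomologyHeckeModule N R} (hv : v ∈ fixedPart N h9 R) :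
    homologyToFibre N h9 R v ∈ LinearMap.ker (1 - shiftOneR N h9 R) := by
  rw [homologyToFibre_mem_ker_iff, (mem_fixedPart_iff N h9 R v).mp hv, sub_self]
  exact Submodule.zero_mem _

/-- The connecting vector vanishes iff `v ∈ H^t`: `t v − v = 0 ↔ v ∈ fixedPart`; so the kernel of
`Φ₁ → B_R`, `v̄ ↦ t v − v`, is the image of `H^t` (exactness of `0 → (H^t + B_R)/B_R → Φ₁ → B_R` at `Φ₁`).
[cite: Harrison2011X0108, §2 (derived reading)] -/
theorem shift_sub_self_eq_zero_iff (v : CuspidalHomologyHeckeModule N R) :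
    shift N h9 R v - v = 0 ↔ v ∈ fixedPart N h9 R := by
  rw [sub_eq_zero, mem_fixedPart_iff]

/-- Exactness at `Φ₁`, elementwise: if `homologyToFibre v ∈ Φ₁` and its connecting vector `t v − v ∈ B_R` is
ALREADY of the form `t b − b`... — more usefully: two lifts `v, v'` of the same element of `V₁(R)` differ by
`B_R`, on which `t − 1` vanishes, so the connecting vector `t v − v` depends only on `homologyToFibre v`.
[cite: Harrison2011X0108, §2 (derived reading: t = 1 on B_R)] -/
theorem shift_sub_self_eq_of_homologyToFibre_eq {v v' : CuspidalHomologyHeckeModule N R}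
    (h : homologyToFibre N h9 R v = homologyToFibre N h9 R v') :
    shift N h9 R v - v = shift N h9 R v' - v' := by
  have hb : v - v' ∈ fixedLatticeFibre N h9 R := by
    rw [← homologyToFibre_eq_zero_iff, map_sub, h, sub_self]
  have ht := shift_apply_eq_self_of_mem_fixedLatticeFibre N h9 R hb
  rw [map_sub] at ht
  -- `t v − t v' = v − v'`
  have : shift N h9 R v - v - (shift N h9 R v' - v') = (shift N h9 R v - shift N h9 R v') - (v - v') := by abel
  rw [← sub_eq_zero, this, ht, sub_self]

variable {N R} in
/-- The connecting vector is `T_p`-equivariant for `p ≡ 1 (mod 3)`: `t(T_p v) − T_p v = T_p(t v − v)`.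
[cite: DiamondShurman2005, Prop. 5.2.2(a) (derived reading, see `shift_comp_heckeOp_of_mod_three_eq_one`)] -/
theorem shift_sub_self_heckeOp_of_mod_three_eq_one {p : ℕ} (hp : p.Prime) (hp1 : p % 3 = 1)
    (v : CuspidalHomologyHeckeModule N R) :
    shift N h9 R (heckeOp N R p hp v) - heckeOp N R p hp v = heckeOp N R p hp (shift N h9 R v - v) := by
  have h := LinearMap.congr_fun (shift_comp_heckeOp_of_mod_three_eq_one N h9 R hp hp1) v
  simp only [LinearMap.comp_apply] at h
  rw [h, map_sub]

variable {N R} in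
/-- The connecting vector is `χ₋₃`-semilinear for `p ≡ 2 (mod 3)`: `t(T_p v) − T_p v = T_p((t + 1)(t v − v))`
(and `t + 1 = 2 = −1` on `B_{𝔽₃}` where `t = 1`: the connecting map `Φ₁ → B_{𝔽₃}` twists the eigen-system by `χ₋₃`).
[cite: DiamondShurman2005, Prop. 5.2.2(a) (derived reading, see `shift_comp_heckeOp_of_mod_three_eq_two`)] -/
theorem shift_sub_self_heckeOp_of_mod_three_eq_two {p : ℕ} (hp : p.Prime) (hp2 : p % 3 = 2)
    (v : CuspidalHomologyHeckeModule N R) :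
    shift N h9 R (heckeOp N R p hp v) - heckeOp N R p hp v =
      heckeOp N R p hp (shift N h9 R (shift N h9 R v - v) + (shift N h9 R v - v)) := by
  have h := LinearMap.congr_fun (shift_comp_heckeOp_of_mod_three_eq_two N h9 R hp hp2) v
  simp only [LinearMap.comp_apply] at h
  rw [h]
  simp only [map_sub, map_add]
  abel

/-- On `B_R` the factor `t + 1` is `2`: for `b ∈ B_R`, `t b + b = 2b` (so over `𝔽₃` it is `−b`).
[cite: Harrison2011X0108, §2 (derived reading: t = 1 on B_R)] -/
theorem shift_add_self_of_mem_fixedLatticeFibre {b : CuspidalHomologyHeckeModule N R}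
    (hb : b ∈ fixedLatticeFibre N h9 R) : shift N h9 R b + b = (2 : R) • b := by
  rw [shift_apply_eq_self_of_mem_fixedLatticeFibre N h9 R hb, two_smul]

end PhiOne

/-! ### §4 The `⟨t⟩`-invariants reduction over `𝔽₃`: `Φ₁ ∩ V₁[c^∞] = 0` from `H^t` and `B_{𝔽₃}`
(memo §13.10 (i), with the Hecke bookkeeping made explicit)

Write `H = H(N; 𝔽₃)` (avatar of `J[3]`), `B = B_{𝔽₃}` (`B[3]`), `H^t = fixedPart` (`J[3]^t`),
`π = homologyToFibre : H ↠ V₁(𝔽₃)` (kernel `B`), `Φ₁ = ker(1 − t̄)` (`(J/B)[3]^t`). The long exact sequence of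
`⟨t⟩`-invariants of `0 → B → H → H/B → 0` is `0 → B → H^t → Φ₁ —δ→ B`, `δ(π v) = t v − v`
(`H¹(⟨t⟩, B) = Hom(C₃, B) = B` as `t = 1` on `B`). HECKE BOOKKEEPING (the point of this section): `V₁(𝔽₃)` carries
the RESTRICTED action `T̄_p` of `Λ₁ ⊂ Λ`; `π T_p = T̄_p π` for `p ≡ 1`, `π T_p = T̄_p (t̄ + 1) π` for `p ≡ 2 (mod 3)`
with `t̄ + 1 = −1` on `Φ₁`; and `t(T_p v) − T_p v = χ₋₃(p) T_p (t v − v)` once `t v − v ∈ B`. The two signs CANCEL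
along `δ ∘ π`: a joint generalised `T̄_p`-eigenvector `x ∈ Φ₁` with values `c_p` lifts — exactness of joint
generalised eigenspaces, `CommutingFamily.map_biInf_maxGenEigenspace_eq_of_comp_eq` — to a joint generalised
`T_p`-eigenvector `v ∈ H` with the TWISTED values `χ₋₃(p) c_p`, whose connecting vector `t v − v ∈ B` is a joint
generalised `T_p`-eigenvector with the UNTWISTED values `c_p`. Hence
`genIsotypicOne_inf_ker_eq_bot_of_fixedPart_of_fixedLatticeFibre`:
  `Φ₁ ∩ V₁[c^∞] = 0` provided `H^t ∩ H[(χ₋₃ c)^∞] ⊆ B` and `B ∩ H[c^∞] = 0`,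
and, composed with `genIsotypicOne_le_range_of_inf_ker_eq_bot` (p666957), the saturation hypothesis
`V₁[a^∞] ⊆ (1 − t̄)V₁(𝔽₃)` of LINE 28's `PS_of` for the system `a` follows from `H^t ∩ H[a^∞] ⊆ B`
("`(J[3]^t)[a] ⊆ B[3]`") and `B ∩ H[(χ₋₃ a)^∞] = 0` ("`B[3][χ₋₃ a] = 0`"):
`genIsotypicOne_le_range_of_fixedPart_of_fixedLatticeFibre`. No Galois action is used; the two inclusions are
where the Galois-side inputs enter. -/

section Invariants

variable (N : ℕ) [NeZero N] (h9 : 3 ^ 2 ∣ N)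

/-- Intertwining on a stable submodule transports generalised eigenvectors: if `W` is `f`-stable and
`D (f w) = f' (D w)` for `w ∈ W`, then `D` maps `W ∩ M_μ(f)` into `M'_μ(f')`. [folklore] -/
private theorem apply_mem_maxGenEigenspace_of_forall_mem {R₀ : Type*} [CommRing R₀] {M M' : Type*}
    [AddCommGroup M] [Module R₀ M] [AddCommGroup M'] [Module R₀ M'] (W : Submodule R₀ M) (D : M →ₗ[R₀] M')
    (f : Module.End R₀ M) (f' : Module.End R₀ M') (hW : ∀ w ∈ W, f w ∈ W)
    (hD : ∀ w ∈ W, D (f w) = f' (D w)) (μ : R₀) {w : M} (hw : w ∈ W) (hμ : w ∈ f.maxGenEigenspace μ) :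
    D w ∈ f'.maxGenEigenspace μ := by
  obtain ⟨k, hk⟩ := (Module.End.mem_maxGenEigenspace _ _ _).mp hμ
  refine (Module.End.mem_maxGenEigenspace _ _ _).mpr ⟨k, ?_⟩
  have key : ∀ (n : ℕ) (w : M), w ∈ W →
      ((f - μ • (1 : Module.End R₀ M)) ^ n) w ∈ W ∧
        D (((f - μ • (1 : Module.End R₀ M)) ^ n) w) = ((f' - μ • (1 : Module.End R₀ M')) ^ n) (D w) := by
    intro n
    induction n with
    | zero =>
      intro w hw
      exact ⟨by simpa only [pow_zero, Module.End.one_apply] using hw, by simp only [pow_zero, Module.End.one_apply]⟩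
    | succ n ih =>
      intro w hw
      have hfw : (f - μ • (1 : Module.End R₀ M)) w ∈ W := by
        rw [LinearMap.sub_apply, LinearMap.smul_apply, Module.End.one_apply]
        exact W.sub_mem (hW w hw) (W.smul_mem μ hw)
      obtain ⟨hmem, heq⟩ := ih _ hfw
      refine ⟨by rw [pow_succ, Module.End.mul_apply]; exact hmem, ?_⟩
      rw [pow_succ, Module.End.mul_apply, heq, pow_succ, Module.End.mul_apply, LinearMap.sub_apply,
        LinearMap.smul_apply, Module.End.one_apply, map_sub, map_smul, hD w hw, LinearMap.sub_apply,
        LinearMap.smul_apply, Module.End.one_apply]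
  have h := (key k w hw).2
  rw [hk, map_zero] at h
  exact h.symm

/-- Scaling an operator and its eigenvalue by the same scalar preserves generalised eigenvectors. [folklore] -/
private theorem mem_maxGenEigenspace_smul_of_mem {R₀ : Type*} [CommRing R₀] {M : Type*} [AddCommGroup M]
    [Module R₀ M] (f : Module.End R₀ M) (u μ : R₀) {x : M} (hx : x ∈ f.maxGenEigenspace μ) :
    x ∈ (u • f).maxGenEigenspace (u * μ) := by
  obtain ⟨k, hk⟩ := (Module.End.mem_maxGenEigenspace _ _ _).mp hx
  refine (Module.End.mem_maxGenEigenspace _ _ _).mpr ⟨k, ?_⟩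
  rw [show u • f - (u * μ) • (1 : Module.End R₀ M) = u • (f - μ • (1 : Module.End R₀ M)) by
      rw [smul_sub, mul_smul],
    smul_pow, LinearMap.smul_apply, hk, smul_zero]

/-- … and conversely when the scalar is an involution (`u² = 1`, e.g. `u = χ₋₃(p)`). [folklore] -/
private theorem mem_maxGenEigenspace_of_mem_smul {R₀ : Type*} [CommRing R₀] {M : Type*} [AddCommGroup M]
    [Module R₀ M] (f : Module.End R₀ M) {u : R₀} (hu : u * u = 1) (μ : R₀) {x : M}
    (hx : x ∈ (u • f).maxGenEigenspace (u * μ)) : x ∈ f.maxGenEigenspace μ := by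
  have h := mem_maxGenEigenspace_smul_of_mem (u • f) u (u * μ) hx
  rwa [smul_smul, hu, one_smul, ← mul_assoc, hu, one_mul] at h

/-- Twisted intertwining on a stable submodule: if `W` is `f`-stable and `D (f w) = u • f' (D w)` on `W` with
`u² = 1`, then `D` maps `W ∩ M_μ(f)` into `M'_{uμ}(f')`. (Generic — kept off the tensor carriers.) [folklore] -/
private theorem apply_mem_maxGenEigenspace_of_forall_mem_twist {R₀ : Type*} [CommRing R₀] {M M' : Type*}
    [AddCommGroup M] [Module R₀ M] [AddCommGroup M'] [Module R₀ M'] (W : Submodule R₀ M) (D : M →ₗ[R₀] M')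
    (f : Module.End R₀ M) (f' : Module.End R₀ M') {u : R₀} (hu : u * u = 1) (hW : ∀ w ∈ W, f w ∈ W)
    (hD : ∀ w ∈ W, D (f w) = u • f' (D w)) (μ : R₀) {w : M} (hw : w ∈ W) (hμ : w ∈ f.maxGenEigenspace μ) :
    D w ∈ f'.maxGenEigenspace (u * μ) := by
  have h1 : D w ∈ (u • f').maxGenEigenspace μ :=
    apply_mem_maxGenEigenspace_of_forall_mem W D f (u • f') hW
      (fun w hw ↦ by rw [hD w hw, LinearMap.smul_apply]) μ hw hμ
  rw [show μ = u * (u * μ) by rw [← mul_assoc, hu, one_mul]] at h1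
  exact mem_maxGenEigenspace_of_mem_smul f' hu (u * μ) h1

/-- Operators induced on the target of a surjection by commuting operators commute. [folklore] -/
private theorem commute_of_comp_eq_of_surjective {R₀ : Type*} [CommRing R₀] {M M' : Type*} [AddCommGroup M]
    [Module R₀ M] [AddCommGroup M'] [Module R₀ M'] (T : M →ₗ[R₀] M') (hT : Function.Surjective T)
    {f g : Module.End R₀ M} {f' g' : Module.End R₀ M'} (hf : T ∘ₗ f = f' ∘ₗ T) (hg : T ∘ₗ g = g' ∘ₗ T)
    (h : Commute f g) : Commute f' g' := by
  refine LinearMap.ext fun y ↦ ?_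
  obtain ⟨x, rfl⟩ := hT y
  have hf' : ∀ z, f' (T z) = T (f z) := fun z ↦ by
    simpa only [LinearMap.comp_apply] using (LinearMap.congr_fun hf z).symm
  have hg' : ∀ z, g' (T z) = T (g z) := fun z ↦ by
    simpa only [LinearMap.comp_apply] using (LinearMap.congr_fun hg z).symm
  rw [Module.End.mul_apply, Module.End.mul_apply, hg' x, hf' (g x), hf' x, hg' (f x), ← Module.End.mul_apply,
    h.eq, Module.End.mul_apply]

variable {N} in
/-- A prime `p ≠ 3` is `≡ 1` or `≡ 2 (mod 3)`. [folklore] -/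
private theorem mod_three_eq_one_or_two {p : ℕ} (hp : p.Prime) (hp3 : p ≠ 3) : p % 3 = 1 ∨ p % 3 = 2 := by
  have h0 : p % 3 ≠ 0 := fun h0 ↦
    hp3 ((Nat.prime_dvd_prime_iff_eq Nat.prime_three hp).mp (Nat.dvd_of_mod_eq_zero h0)).symm
  have hlt : p % 3 < 3 := Nat.mod_lt _ (by norm_num)
  omega

/-- `t̄ = 1` on `Φ₁ = ker(1 − t̄)`. [cite: Harrison2011X0108, §2 (derived reading)] -/
theorem shiftOneR_apply_eq_self_of_mem_ker {w : ShiftSubOneModule N h9 (ZMod 3)}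
    (hw : w ∈ LinearMap.ker (1 - shiftOneR N h9 (ZMod 3))) : shiftOneR N h9 (ZMod 3) w = w := by
  rw [LinearMap.mem_ker, LinearMap.sub_apply, Module.End.one_apply, sub_eq_zero] at hw
  exact hw.symm

variable {N} in
/-- **`Φ₁ = ker(1 − t̄) ⊆ V₁(𝔽₃)` is `T̄_p`-stable** (`p ≠ 3` prime; from `T̄_p ε = χ₋₃(p) ε T̄_p`, `ε = 1 − t̄`).
[cite: DiamondShurman2005, §6.3 (derived reading, see `heckeOneR_one_sub_shiftOneR_apply_eq_twist`)] -/
theorem heckeOneR_apply_mem_ker_one_sub_shiftOneR {p : ℕ} (hp : p.Prime) (hp3 : p ≠ 3)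
    {x : ShiftSubOneModule N h9 (ZMod 3)} (hx : x ∈ LinearMap.ker (1 - shiftOneR N h9 (ZMod 3))) :
    heckeOneR h9 hp hp3 x ∈ LinearMap.ker (1 - shiftOneR N h9 (ZMod 3)) := by
  rw [LinearMap.mem_ker] at hx ⊢
  have h := heckeOneR_one_sub_shiftOneR_apply_eq_twist h9 hp hp3 x
  rw [hx, map_zero] at h
  have h2 := congrArg (fun y ↦ twistSign (ZMod 3) p • y) h
  simp only [smul_zero, smul_smul, twistSign_mul_self, one_smul] at h2
  exact h2.symm

variable {N} in
/-- On `Φ₁` the `p ≡ 2 (mod 3)` intertwiner `T̄_p (t̄ + 1)` of `π T_p = T̄_p (t̄ + 1) π` is `χ₋₃(p) T̄_p = −T̄_p`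
(`t̄ = 1` on `Φ₁`, `2 = −1` in `𝔽₃`). [cite: DiamondShurman2005, §6.3 (derived reading: bookkeeping)] -/
theorem heckeOneR_shiftOneR_add_one_apply_of_mem_ker {p : ℕ} (hp : p.Prime) (hp3 : p ≠ 3) (hp2 : p % 3 = 2)
    {w : ShiftSubOneModule N h9 (ZMod 3)} (hw : w ∈ LinearMap.ker (1 - shiftOneR N h9 (ZMod 3))) :
    (heckeOneR h9 hp hp3 ∘ₗ (shiftOneR N h9 (ZMod 3) + 1)) w =
      twistSign (ZMod 3) p • heckeOneR h9 hp hp3 w := by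
  have hs : twistSign (ZMod 3) p = 2 := by
    rw [twistSign, if_neg (by omega)]
    decide
  rw [LinearMap.comp_apply, LinearMap.add_apply, Module.End.one_apply,
    shiftOneR_apply_eq_self_of_mem_ker N h9 hw, map_add, hs, two_smul]

set_option maxHeartbeats 400000 in
-- the generic twist lemma is instantiated on the tensor carrier `V₁(𝔽₃)`: instance-path unification is whnf-heavy
variable {N} in
/-- **On `Φ₁`, generalised `T̄_p`-eigenvectors for `c` are generalised `T̄_p(t̄ + 1)`-eigenvectors for `χ₋₃(p)c`**
(`p ≡ 2 (mod 3)`; `T̄_p(t̄ + 1) = χ₋₃(p) T̄_p` on the `T̄_p`-stable subspace `Φ₁`). This is the eigenvalue bookkeeping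
for the intertwiner of `π T_p = T̄_p(t̄ + 1) π`. [cite: DiamondShurman2005, §6.3 (derived reading: bookkeeping)] -/
theorem mem_maxGenEigenspace_heckeOneR_comp_shiftOneR_add_one {p : ℕ} (hp : p.Prime) (hp3 : p ≠ 3)
    (hp2 : p % 3 = 2) (c : ZMod 3) {x : ShiftSubOneModule N h9 (ZMod 3)}
    (hx : x ∈ LinearMap.ker (1 - shiftOneR N h9 (ZMod 3)))
    (hc : x ∈ (heckeOneR h9 hp hp3 (R := ZMod 3)).maxGenEigenspace c) :
    x ∈ Module.End.maxGenEigenspace (heckeOneR h9 hp hp3 ∘ₗ (shiftOneR N h9 (ZMod 3) + 1))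
      (twistSign (ZMod 3) p * c) := by
  have hA := apply_mem_maxGenEigenspace_of_forall_mem_twist (LinearMap.ker (1 - shiftOneR N h9 (ZMod 3)))
    LinearMap.id (heckeOneR h9 hp hp3) (heckeOneR h9 hp hp3 ∘ₗ (shiftOneR N h9 (ZMod 3) + 1))
    (twistSign_mul_self (ZMod 3) p) (fun w hw ↦ heckeOneR_apply_mem_ker_one_sub_shiftOneR h9 hp hp3 hw)
    (fun w hw ↦ by
      rw [LinearMap.id_apply, LinearMap.id_apply, heckeOneR_shiftOneR_add_one_apply_of_mem_ker h9 hp hp3 hp2 hw,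
        smul_smul, twistSign_mul_self, one_smul])
    c hx hc
  rw [LinearMap.id_apply] at hA
  exact hA

variable {N} in
/-- **The connecting vector intertwines `T_p` with `χ₋₃(p) T_p`**: if `t u − u ∈ B_{𝔽₃}` then
`t(T_p u) − T_p u = χ₋₃(p) • T_p (t u − u)` (`p ≠ 3` prime; for `p ≡ 2`: `T_p (t + 1)(t u − u)` with `t = 1` on
`B_{𝔽₃}` and `2 = −1`). [cite: DiamondShurman2005, Prop. 5.2.2(a) (derived reading: `shift_sub_self_heckeOp_of_mod_three_eq_one/two` with t = 1 on B_R)] -/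
theorem shift_sub_self_heckeOp_eq_twistSign_smul {p : ℕ} (hp : p.Prime) (hp3 : p ≠ 3)
    {u : CuspidalHomologyHeckeModule N (ZMod 3)}
    (hu : shift N h9 (ZMod 3) u - u ∈ fixedLatticeFibre N h9 (ZMod 3)) :
    shift N h9 (ZMod 3) (heckeOp N (ZMod 3) p hp u) - heckeOp N (ZMod 3) p hp u =
      twistSign (ZMod 3) p • heckeOp N (ZMod 3) p hp (shift N h9 (ZMod 3) u - u) := by
  rcases mod_three_eq_one_or_two hp hp3 with h1 | h2
  · rw [shift_sub_self_heckeOp_of_mod_three_eq_one h9 hp h1, twistSign, if_pos h1, one_smul]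
  · have hs : twistSign (ZMod 3) p = 2 := by
      rw [twistSign, if_neg (by omega)]
      decide
    rw [shift_sub_self_heckeOp_of_mod_three_eq_two h9 hp h2,
      shift_apply_eq_self_of_mem_fixedLatticeFibre N h9 (ZMod 3) hu, map_add, hs, two_smul]

variable {N} in
/-- **The preimage `π⁻¹(Φ₁) = {u : t u − u ∈ B_{𝔽₃}}` is `T_p`-stable** (`p ≠ 3`; `B_{𝔽₃}` is `T_p`-stable).
[cite: DiamondShurman2005, Prop. 5.2.2(a) (derived reading, see `shift_sub_self_heckeOp_eq_twistSign_smul`)] -/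
theorem heckeOp_mem_comap_shift_sub_one {p : ℕ} (hp : p.Prime) (hp3 : p ≠ 3)
    {u : CuspidalHomologyHeckeModule N (ZMod 3)}
    (hu : u ∈ (fixedLatticeFibre N h9 (ZMod 3)).comap (shift N h9 (ZMod 3) - 1)) :
    heckeOp N (ZMod 3) p hp u ∈ (fixedLatticeFibre N h9 (ZMod 3)).comap (shift N h9 (ZMod 3) - 1) := by
  rw [Submodule.mem_comap, LinearMap.sub_apply, Module.End.one_apply] at hu ⊢
  rw [shift_sub_self_heckeOp_eq_twistSign_smul h9 hp hp3 hu]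
  exact Submodule.smul_mem _ _ (heckeOp_mem_fixedLatticeFibre h9 hp hp3 hu)

variable {N} in
/-- **The connecting vector of a twisted generalised eigenvector is an untwisted one**: if `t u − u ∈ B_{𝔽₃}`
and `u ∈ H[(T_p − χ₋₃(p)c)^∞]`, then `t u − u ∈ H[(T_p − c)^∞]` (`χ₋₃(p)² = 1`).
[cite: DiamondShurman2005, §6.3 (derived reading: bookkeeping over `shift_sub_self_heckeOp_eq_twistSign_smul`)] -/
theorem shift_sub_self_mem_maxGenEigenspace {p : ℕ} (hp : p.Prime) (hp3 : p ≠ 3) (c : ZMod 3)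
    {u : CuspidalHomologyHeckeModule N (ZMod 3)}
    (hu : shift N h9 (ZMod 3) u - u ∈ fixedLatticeFibre N h9 (ZMod 3))
    (hgen : u ∈ Module.End.maxGenEigenspace (heckeOp N (ZMod 3) p hp) (twistSign (ZMod 3) p * c)) :
    shift N h9 (ZMod 3) u - u ∈ Module.End.maxGenEigenspace (heckeOp N (ZMod 3) p hp) c := by
  have hA := apply_mem_maxGenEigenspace_of_forall_mem_twist
    ((fixedLatticeFibre N h9 (ZMod 3)).comap (shift N h9 (ZMod 3) - 1)) (shift N h9 (ZMod 3) - 1)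
    (heckeOp N (ZMod 3) p hp) (heckeOp N (ZMod 3) p hp) (twistSign_mul_self (ZMod 3) p)
    (fun w hw ↦ heckeOp_mem_comap_shift_sub_one h9 hp hp3 hw)
    (fun w hw ↦ by
      rw [Submodule.mem_comap, LinearMap.sub_apply, Module.End.one_apply] at hw
      rw [LinearMap.sub_apply, Module.End.one_apply, LinearMap.sub_apply, Module.End.one_apply,
        shift_sub_self_heckeOp_eq_twistSign_smul h9 hp hp3 hw])
    (twistSign (ZMod 3) p * c) (w := u)
    (by rw [Submodule.mem_comap, LinearMap.sub_apply, Module.End.one_apply]; exact hu) hgen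
  rwa [LinearMap.sub_apply, Module.End.one_apply, ← mul_assoc, twistSign_mul_self, one_mul] at hA

set_option maxHeartbeats 400000 in
-- one application of the generic exactness lemma on the tensor carriers (instance-path unification)
/-- **The `⟨t⟩`-invariants reduction** (memo §13.10 (i), typed; no Galois action used). Let `S` be a finite
set of primes and `c_p ∈ 𝔽₃`. Suppose
(1) `H^t ∩ H[(χ₋₃ c)^∞] ⊆ B_{𝔽₃}`: every `t`-fixed `v ∈ H(N; 𝔽₃)` that is a joint generalised `T_p`-eigenvector with
    values `χ₋₃(p) c_p` (`p ∈ S`, `p ≠ 3`) lies in `B_{𝔽₃}` ("`(J[3]^t)[χ₋₃ c] ⊆ B[3]`"), and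
(2) `B_{𝔽₃} ∩ H[c^∞] = 0`: no non-zero `b ∈ B_{𝔽₃}` is a joint generalised `T_p`-eigenvector with values `c_p`
    ("`B[3][c] = 0`").
Then `Φ₁ ∩ V₁(𝔽₃)[c^∞] = 0`: `genIsotypicOne ↑S c ⊓ ker(1 − t̄) = ⊥`. (Proof: the exact sequence
`0 → B → H^t → Φ₁ → B` of `⟨t⟩`-invariants of `0 → B[3] → J[3] → (J/B)[3] → 0` on the modular-symbol avatars,
with exactness of joint generalised eigenspaces `CommutingFamily.map_biInf_maxGenEigenspace_eq_of_comp_eq`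
for the lift and the twist bookkeeping of this section.) [cite: Jacobson1989BasicAlgebraII, §3.4 Fitting's lemma (38), p. 113 (derived reading: exactness of generalised eigenspaces on finite modules, `map_biInf_maxGenEigenspace_eq_of_comp_eq`, applied to `homologyToFibre`)] -/
theorem genIsotypicOne_inf_ker_eq_bot_of_fixedPart_of_fixedLatticeFibre (S : Finset ℕ) (c : ℕ → ZMod 3)
    (hJt : ∀ v ∈ fixedPart N h9 (ZMod 3),
      (∀ (p : ℕ) (hp : p.Prime), p ≠ 3 → p ∈ S →
        v ∈ Module.End.maxGenEigenspace (heckeOp N (ZMod 3) p hp) (twistSystem (ZMod 3) c p)) →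
      v ∈ fixedLatticeFibre N h9 (ZMod 3))
    (hB : ∀ b ∈ fixedLatticeFibre N h9 (ZMod 3),
      (∀ (p : ℕ) (hp : p.Prime), p ≠ 3 → p ∈ S → b ∈ Module.End.maxGenEigenspace (heckeOp N (ZMod 3) p hp) (c p)) →
      b = 0) :
    genIsotypicOne N h9 (ZMod 3) ↑S c ⊓ LinearMap.ker (1 - shiftOneR N h9 (ZMod 3)) = ⊥ := by
  rw [eq_bot_iff]
  intro x hx
  obtain ⟨hxc, hxΦ⟩ := Submodule.mem_inf.mp hx
  rw [Submodule.mem_bot]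
  -- finiteness: `H(N; 𝔽₃)` and `V₁(𝔽₃)` are finite
  haveI : Module.Finite (ZMod 3) (CuspidalHomologyHeckeModule N (ZMod 3)) := moduleFinite N (ZMod 3)
  haveI : Finite (CuspidalHomologyHeckeModule N (ZMod 3)) := Module.finite_of_finite (ZMod 3)
  haveI : IsArtinian (ZMod 3) (CuspidalHomologyHeckeModule N (ZMod 3)) := isArtinian_of_finite
  haveI : Module.Finite (ZMod 3) (ShiftSubOneModule N h9 (ZMod 3)) := moduleFinite_shiftSubOneModule N h9 (ZMod 3)
  haveI : IsNoetherian (ZMod 3) (ShiftSubOneModule N h9 (ZMod 3)) := inferInstance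
  have hsurj := homologyToFibre_surjective N h9 (ZMod 3)
  -- the index set, and the intertwining `π T_p = G_p π` with `G_p = T̄_p` resp. `T̄_p (t̄ + 1)`
  have hT : ∀ i ∈ S.subtype (fun p : ℕ ↦ p.Prime ∧ p ≠ 3),
      homologyToFibre N h9 (ZMod 3) ∘ₗ heckeOp N (ZMod 3) i.1 i.2.1 =
        (if i.1 % 3 = 1 then heckeOneR h9 i.2.1 i.2.2
          else heckeOneR h9 i.2.1 i.2.2 ∘ₗ (shiftOneR N h9 (ZMod 3) + 1)) ∘ₗ homologyToFibre N h9 (ZMod 3) := by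
    intro i _
    rcases mod_three_eq_one_or_two i.2.1 i.2.2 with h1 | h2
    · rw [if_pos h1]
      exact homologyToFibre_comp_heckeOp_of_mod_three_eq_one h9 i.2.1 i.2.2 h1
    · rw [if_neg (by omega), LinearMap.comp_assoc]
      exact homologyToFibre_comp_heckeOp_of_mod_three_eq_two h9 i.2.1 i.2.2 h2
  have hcF : ∀ i ∈ S.subtype (fun p : ℕ ↦ p.Prime ∧ p ≠ 3), ∀ j ∈ S.subtype (fun p : ℕ ↦ p.Prime ∧ p ≠ 3),
      Commute (heckeOp N (ZMod 3) i.1 i.2.1) (heckeOp N (ZMod 3) j.1 j.2.1) := by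
    intro i _ j _
    change heckeOp N (ZMod 3) i.1 i.2.1 * heckeOp N (ZMod 3) j.1 j.2.1 =
      heckeOp N (ZMod 3) j.1 j.2.1 * heckeOp N (ZMod 3) i.1 i.2.1
    rw [Module.End.mul_eq_comp, Module.End.mul_eq_comp]
    exact heckeOp_comm N (ZMod 3) i.1 j.1 i.2.1 j.2.1
  have hexact := Literature.LinearAlgebra.CommutingFamily.map_biInf_maxGenEigenspace_eq_of_comp_eq
    (S.subtype (fun p : ℕ ↦ p.Prime ∧ p ≠ 3)) (fun i ↦ heckeOp N (ZMod 3) i.1 i.2.1)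
    (fun i ↦ if i.1 % 3 = 1 then heckeOneR h9 i.2.1 i.2.2
      else heckeOneR h9 i.2.1 i.2.2 ∘ₗ (shiftOneR N h9 (ZMod 3) + 1))
    (fun i ↦ twistSystem (ZMod 3) c i.1) hcF
    (fun i hi j hj ↦ commute_of_comp_eq_of_surjective _ hsurj (hT i hi) (hT j hj) (hcF i hi j hj))
    (homologyToFibre N h9 (ZMod 3)) hT hsurj
  -- `x` lies in the joint generalised eigenspace of the `G_p` for the twisted values, hence lifts
  have hxG : x ∈ (⨅ i ∈ S.subtype (fun p : ℕ ↦ p.Prime ∧ p ≠ 3),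
      Module.End.maxGenEigenspace ((fun i ↦ heckeOp N (ZMod 3) i.1 i.2.1) i) ((fun i ↦ twistSystem (ZMod 3) c i.1) i)).map
        (homologyToFibre N h9 (ZMod 3)) := by
    rw [hexact, Submodule.mem_iInf]
    intro i
    rw [Submodule.mem_iInf]
    intro hi
    have hpS : i.1 ∈ S := Finset.mem_subtype.mp hi
    have hxi : x ∈ (heckeOneR h9 i.2.1 i.2.2 (R := ZMod 3)).maxGenEigenspace (c i.1) := by
      have h := hxc
      simp only [genIsotypicOne, Submodule.mem_iInf, Finset.mem_coe] at h
      exact h i.1 i.2.1 i.2.2 hpS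
    rcases mod_three_eq_one_or_two i.2.1 i.2.2 with h1 | h2
    · simp only [if_pos h1, twistSystem_apply, twistSign, one_mul]
      exact hxi
    · simp only [if_neg (show ¬ (i.1 % 3 = 1) by omega), twistSystem_apply]
      exact mem_maxGenEigenspace_heckeOneR_comp_shiftOneR_add_one h9 i.2.1 i.2.2 h2 (c i.1) hxΦ hxi
  obtain ⟨v, hv, hvx⟩ := Submodule.mem_map.mp hxG
  have hv' : ∀ (p : ℕ) (hp : p.Prime) (hp3 : p ≠ 3), p ∈ S →
      v ∈ Module.End.maxGenEigenspace (heckeOp N (ZMod 3) p hp) (twistSystem (ZMod 3) c p) := by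
    intro p hp hp3 hpS
    simp only [Submodule.mem_iInf] at hv
    exact hv ⟨p, hp, hp3⟩ (Finset.mem_subtype.mpr hpS)
  -- the connecting vector `t v − v ∈ B` is a joint generalised eigenvector for the untwisted values, so it is `0`
  have hvΦ : homologyToFibre N h9 (ZMod 3) v ∈ LinearMap.ker (1 - shiftOneR N h9 (ZMod 3)) := by
    rw [hvx]; exact hxΦ
  have hd : shift N h9 (ZMod 3) v - v ∈ fixedLatticeFibre N h9 (ZMod 3) :=
    (homologyToFibre_mem_ker_iff N h9 (ZMod 3) v).mp hvΦ
  have hd0 : shift N h9 (ZMod 3) v - v = 0 :=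
    hB _ hd fun p hp hp3 hpS ↦ shift_sub_self_mem_maxGenEigenspace h9 hp hp3 (c p) hd
      (by rw [← twistSystem_apply]; exact hv' p hp hp3 hpS)
  -- so `v` is `t`-fixed, hence in `B` by (1), and `x = π v = 0`
  have hvt : v ∈ fixedPart N h9 (ZMod 3) := (shift_sub_self_eq_zero_iff N h9 (ZMod 3) v).mp hd0
  have hvB : v ∈ fixedLatticeFibre N h9 (ZMod 3) := hJt v hvt hv'
  rw [← hvx]
  exact (homologyToFibre_eq_zero_iff N h9 (ZMod 3) v).mpr hvB

/-- **The saturation hypothesis of LINE 28 from `H^t` and `B_{𝔽₃}`**: for a finite set of primes `S` and a system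
`a_p ∈ 𝔽₃`, if `H^t ∩ H[a^∞] ⊆ B_{𝔽₃}` ("`(J[3]^t)[a] ⊆ B[3]`") and `B_{𝔽₃} ∩ H[(χ₋₃ a)^∞] = 0`
("`B[3][χ₋₃ a] = 0`"), then `V₁(𝔽₃)[a^∞] ⊆ (1 − t̄)V₁(𝔽₃)` — the `genIsotypicOne … ≤ LinearMap.range (1 − shiftOneR …)`
hypothesis of `PS_of` (composition of `genIsotypicOne_inf_ker_eq_bot_of_fixedPart_of_fixedLatticeFibre` for
`c = χ₋₃ a` with the tree's `genIsotypicOne_le_range_of_inf_ker_eq_bot`; `χ₋₃² = 1`).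
[cite: Jacobson1989BasicAlgebraII, §3.4 Fitting's lemma (38), p. 113 (derived reading, see `genIsotypicOne_inf_ker_eq_bot_of_fixedPart_of_fixedLatticeFibre`)] -/
theorem genIsotypicOne_le_range_of_fixedPart_of_fixedLatticeFibre (S : Finset ℕ) (a : ℕ → ZMod 3)
    (hJt : ∀ v ∈ fixedPart N h9 (ZMod 3),
      (∀ (p : ℕ) (hp : p.Prime), p ≠ 3 → p ∈ S → v ∈ Module.End.maxGenEigenspace (heckeOp N (ZMod 3) p hp) (a p)) →
      v ∈ fixedLatticeFibre N h9 (ZMod 3))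
    (hB : ∀ b ∈ fixedLatticeFibre N h9 (ZMod 3),
      (∀ (p : ℕ) (hp : p.Prime), p ≠ 3 → p ∈ S →
        b ∈ Module.End.maxGenEigenspace (heckeOp N (ZMod 3) p hp) (twistSystem (ZMod 3) a p)) →
      b = 0) :
    genIsotypicOne N h9 (ZMod 3) ↑S a ≤ LinearMap.range (1 - shiftOneR N h9 (ZMod 3)) := by
  refine genIsotypicOne_le_range_of_inf_ker_eq_bot N h9 ↑S a ?_
  refine genIsotypicOne_inf_ker_eq_bot_of_fixedPart_of_fixedLatticeFibre N h9 S (twistSystem (ZMod 3) a)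
    (fun v hv hgen ↦ hJt v hv fun p hp hp3 hpS ↦ ?_) hB
  have h := hgen p hp hp3 hpS
  rwa [twistSystem_twistSystem] at h

end Invariants

end Literature.NumberTheory.ModularSymbols

end
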